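import Summits.CriticalPhenomena.PercolationContinuityZ3.Theorems.PercNearOneGluingNoHeavyLowerTailSahiCTCRtThreeWindowFourDefs
import HarnessLib

/-!
# `NoHeavyLowerTail` (crux stmt-CriticalPhenomena-4575), P3 lane: the local window quantity on `Fin 4` as FIFTEEN WEIGHTED MOMENTS

Support file (seat `prim-l12-p3`, gen 51; `--supports stmt-CriticalPhenomena-4575`).  Memo
`run/shared/lean/prim/prim-l12/FROM-prim-l12-p3-g51-ROW0-ALL-K-LEAN.md`.

The hypothesis of `…RtThreeLocalWindow.coeff_ind_Rt_three_nonneg_of_local`, transported to `univ : Finset (Fin 4)` by `…RtThreeTransport`, is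
`atomSum(local tables at k points) 𝒳 𝒵 univ + (localised small pairs) ≥ 0`.  Here both parts are regrouped by class
(definitions in `…RtThreeWindowFourDefs`):
* `atomSum_Jonly`, `sum_atoms_eq`, `cls_mem_JCLl`, `sum_atoms_by_class` : with only the `J`-table nonzero the atom sum is a sum over the
  `J`-atoms `(A, u, B)`, and regrouping by the class `(n, s)` of the top corner gives
  `atomSum_local_eq` : `atomSum(local tables) = Σ_{(n,s) ∈ JCLl} Wloc k n s · momJ n s 𝒳 𝒵`;
* `pairs_local_eq` : `(localised small pairs) = Σ_{m<5} momP m 𝒳 𝒵 / C(k−m, 4−m)`.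
No new definitions; nothing is asserted about the crux.
-/

noncomputable section

namespace Summit.CriticalPhenomena.PercolationContinuityZ3.Theorems.SahiCTCForms

open Finset

/-! ## Part SUM: the local quantity on `Fin 4` as fifteen weighted moments -/

namespace RtThreeFin4

/-- With only the `J`-table nonzero, the atom weight is `[u = v]·wJ(type)`. [this work] -/
theorem atomΩ_Jonly {α : Type*} [DecidableEq α] (wJ : ℕ → ℕ → ℕ → ℚ) (S : Finset α) (u : α) (S' : Finset α) (v : α) :
    atomΩ wJ (fun _ _ _ => 0) (fun _ _ _ => 0) (fun _ _ _ => 0) (fun _ _ _ => 0) S u S' v =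
      if u = v then wJ #(S ∩ S') #(S \ S') #(S' \ S) else 0 := by
  unfold atomΩ; split_ifs <;> rfl

/-- **The atom sum with only the `J`-table**: a triple sum over `(A, u, B)` with `u ∉ A`, `u ∉ B`. [this work] -/
theorem atomSum_Jonly {α : Type*} [DecidableEq α] (wJ : ℕ → ℕ → ℕ → ℚ) (F G : Finset (Finset α)) (V : Finset α) :
    atomSum wJ (fun _ _ _ => 0) (fun _ _ _ => 0) (fun _ _ _ => 0) (fun _ _ _ => 0) F G V =
      ∑ A ∈ V.powerset, ∑ u ∈ V \ A, ∑ B ∈ V.powerset with u ∉ B,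
        wJ #(insert u A ∩ insert u B) #(insert u A \ insert u B) #(insert u B \ insert u A) *
          ((ιq F (insert u A) - ιq F A) * (ιq G (insert u B) - ιq G B)) := by
  unfold atomSum
  refine sum_congr rfl fun A _ => sum_congr rfl fun u hu => ?_
  have huV : u ∈ V := (mem_sdiff.1 hu).1
  rw [sum_filter]
  refine sum_congr rfl fun B _ => ?_
  simp only [atomΩ_Jonly, ite_mul, zero_mul, sum_ite_eq]
  by_cases huB : u ∈ B
  · rw [if_neg (fun h => (mem_sdiff.1 h).2 huB), if_neg (not_not.2 huB)]
  · rw [if_pos (mem_sdiff.2 ⟨huV, huB⟩), if_pos huB]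

/-- The triple sum over `(A, u, B)` on `Fin 4` is the sum over `atoms`. [this work] -/
theorem sum_atoms_eq (g : Finset (Fin 4) → Fin 4 → Finset (Fin 4) → ℚ) :
    ∑ x ∈ atoms, g x.1 x.2.1 x.2.2 =
      ∑ A ∈ (univ : Finset (Fin 4)).powerset, ∑ u ∈ univ \ A, ∑ B ∈ (univ : Finset (Fin 4)).powerset with u ∉ B, g A u B := by
  unfold atoms
  rw [sum_filter, sum_product]
  refine sum_congr rfl fun A _ => ?_
  rw [sum_product, sdiff_eq_filter, sum_filter]
  refine sum_congr rfl fun u _ => ?_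
  by_cases huA : u ∈ A
  · simp [huA]
  · simp only [huA, not_false_eq_true, true_and, if_true, sum_filter]

/-- The class of a triple `(A, u, B)` is one of the ten classes `JCLl` (`u` lies in both top sets, and there are four points). [this work] -/
theorem cls_mem_JCLl (x : Finset (Fin 4) × Fin 4 × Finset (Fin 4)) : (clsN x, clsS x) ∈ JCLl.toFinset := by
  have key : ∀ n < 5, ∀ s < 5, 1 ≤ n - s → (n, s) ∈ JCLl.toFinset := by decide
  have ha : 1 ≤ #(insert x.2.1 x.1 ∩ insert x.2.1 x.2.2) :=
    card_pos.2 ⟨x.2.1, mem_inter.2 ⟨mem_insert_self _ _, mem_insert_self _ _⟩⟩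
  have hn : #(insert x.2.1 x.1 ∩ insert x.2.1 x.2.2) + #(insert x.2.1 x.1 \ insert x.2.1 x.2.2)
      + #(insert x.2.1 x.2.2 \ insert x.2.1 x.1) ≤ 4 := by
    rw [← card_union_eq_type]; exact (card_le_univ _).trans (by simp)
  unfold clsN clsS
  exact key _ (by omega) _ (by omega) (by omega)

/-- **Regrouping the `J`-atoms by class**: `Σ_{atoms} W(n(x), s(x))·Δ(x) = Σ_{(n,s) ∈ JCLl} W(n,s)·momJ(n,s)`. [this work] -/
theorem sum_atoms_by_class (W : ℕ → ℕ → ℚ) (F G : Finset (Finset (Fin 4))) :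
    ∑ x ∈ atoms, W (clsN x) (clsS x) * ((ιq F (insert x.2.1 x.1) - ιq F x.1) * (ιq G (insert x.2.1 x.2.2) - ιq G x.2.2)) =
      ∑ c ∈ JCLl.toFinset, W c.1 c.2 * momJ c.1 c.2 F G := by
  rw [← sum_fiberwise_of_maps_to (s := atoms) (t := JCLl.toFinset) (g := fun x => (clsN x, clsS x)) (fun x _ => cls_mem_JCLl x)]
  refine sum_congr rfl fun c _ => ?_
  unfold momJ atomsC
  rw [mul_sum]
  have hf : atoms.filter (fun x => (clsN x, clsS x) = c) = atoms.filter (fun x => clsN x = c.1 ∧ clsS x = c.2) :=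
    filter_congr fun x _ => Prod.ext_iff
  rw [hf]
  refine sum_congr rfl fun x hx => ?_
  obtain ⟨_, h1, h2⟩ := mem_filter.1 hx
  rw [h1, h2]

/-- **THE `J`-PART OF THE LOCAL QUANTITY AS TEN WEIGHTED MOMENTS**: on `univ : Finset (Fin 4)`, the atom sum with the local tables at `k`
points (only the `J`-table is nonzero; the other four tables are `0/C`) equals `Σ_{(n,s)} Wloc k n s · momJ n s`. [this work] -/
theorem atomSum_local_eq (k : ℕ) (F G : Finset (Finset (Fin 4))) :
    atomSum
        (fun a b c => (if 5 ≤ a + b + c then 0 else ∑ t ∈ range 3, (((k - a - b - c).choose t : ℕ) : ℚ) *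
          (if b + c < k - t then ((((k - t : ℕ) : ℚ)) * ((((k - t - 1).choose (b + c) : ℕ) : ℚ)))⁻¹ else 0))
          / (((k - (a + b + c)).choose (4 - (a + b + c)) : ℕ) : ℚ))
        (fun a b c => (0 : ℚ) / (((k - (a + b + c)).choose (4 - (a + b + c)) : ℕ) : ℚ))
        (fun a b c => (0 : ℚ) / (((k - (a + b + c)).choose (4 - (a + b + c)) : ℕ) : ℚ))
        (fun a b c => (0 : ℚ) / (((k - (a + b + c)).choose (4 - (a + b + c)) : ℕ) : ℚ))
        (fun a b c => (0 : ℚ) / (((k - (a + b + c)).choose (4 - (a + b + c)) : ℕ) : ℚ)) F G univ =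
      ∑ c ∈ JCLl.toFinset, Wloc k c.1 c.2 * momJ c.1 c.2 F G := by
  have h0 : (fun a b c => (0 : ℚ) / (((k - (a + b + c)).choose (4 - (a + b + c)) : ℕ) : ℚ)) = fun _ _ _ => (0 : ℚ) := by
    funext a b c; exact zero_div _
  have hJ : (fun a b c => (if 5 ≤ a + b + c then 0 else ∑ t ∈ range 3, (((k - a - b - c).choose t : ℕ) : ℚ) *
          (if b + c < k - t then ((((k - t : ℕ) : ℚ)) * ((((k - t - 1).choose (b + c) : ℕ) : ℚ)))⁻¹ else 0))
          / (((k - (a + b + c)).choose (4 - (a + b + c)) : ℕ) : ℚ)) = fun a b c => Wloc k (a + b + c) (b + c) := by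
    funext a b c; simp only [Wloc, Nat.sub_sub]
  rw [h0, hJ, atomSum_Jonly, ← sum_atoms_eq (fun A u B => Wloc k (#(insert u A ∩ insert u B) + #(insert u A \ insert u B)
      + #(insert u B \ insert u A)) (#(insert u A \ insert u B) + #(insert u B \ insert u A)) *
      ((ιq F (insert u A) - ιq F A) * (ιq G (insert u B) - ιq G B)))]
  exact sum_atoms_by_class (Wloc k) F G

/-- **THE SMALL-PAIR PART AS FIVE WEIGHTED MOMENTS**: on `univ : Finset (Fin 4)`, the localised crossing-minus-nested small pairs equal
`Σ_{m<5} momP m / C(k−m, 4−m)`. [this work] -/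
theorem pairs_local_eq (k : ℕ) (F G : Finset (Finset (Fin 4))) :
    ∑ P ∈ (univ : Finset (Fin 4)).powerset, ∑ P' ∈ (univ : Finset (Fin 4)).powerset,
        (ιq (smallXo F G) P * ιq (smallZo F G) P' * (if Disjoint P P' then 1 else 0) / (((k - #(P ∪ P')).choose (4 - #(P ∪ P')) : ℕ) : ℚ)
          - ιq (smallN F G) P * ιq (smallY F G) P' * (if Disjoint P P' then 1 else 0) / (((k - #(P ∪ P')).choose (4 - #(P ∪ P')) : ℕ) : ℚ)) =
      ∑ m ∈ range 5, (1 / (((k - m).choose (4 - m) : ℕ) : ℚ)) * momP m F G := by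
  rw [← sum_product (s := (univ : Finset (Fin 4)).powerset) (t := (univ : Finset (Fin 4)).powerset)
    (f := fun x => ιq (smallXo F G) x.1 * ιq (smallZo F G) x.2 * (if Disjoint x.1 x.2 then 1 else 0)
        / (((k - #(x.1 ∪ x.2)).choose (4 - #(x.1 ∪ x.2)) : ℕ) : ℚ)
      - ιq (smallN F G) x.1 * ιq (smallY F G) x.2 * (if Disjoint x.1 x.2 then 1 else 0)
        / (((k - #(x.1 ∪ x.2)).choose (4 - #(x.1 ∪ x.2)) : ℕ) : ℚ))]
  have hmaps : ∀ x ∈ (univ : Finset (Fin 4)).powerset ×ˢ (univ : Finset (Fin 4)).powerset, #(x.1 ∪ x.2) ∈ range 5 := fun x _ =>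
    mem_range.2 (Nat.lt_succ_of_le ((card_le_univ _).trans (by simp)))
  rw [← sum_fiberwise_of_maps_to hmaps]
  refine sum_congr rfl fun m _ => ?_
  unfold momP pairsC
  rw [mul_sum]
  have hf : ((univ : Finset (Fin 4)).powerset ×ˢ (univ : Finset (Fin 4)).powerset).filter (fun x => Disjoint x.1 x.2 ∧ #(x.1 ∪ x.2) = m) =
      (((univ : Finset (Fin 4)).powerset ×ˢ (univ : Finset (Fin 4)).powerset).filter (fun x => #(x.1 ∪ x.2) = m)).filter
        (fun x => Disjoint x.1 x.2) := by
    rw [filter_filter]; exact filter_congr fun x _ => and_comm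
  rw [hf]
  conv_rhs => rw [sum_filter]
  refine sum_congr rfl fun x hx => ?_
  rw [(mem_filter.1 hx).2]
  by_cases hd : Disjoint x.1 x.2
  · rw [if_pos hd, if_pos hd]; ring
  · rw [if_neg hd, if_neg hd]; ring

end RtThreeFin4

end Summit.CriticalPhenomena.PercolationContinuityZ3.Theorems.SahiCTCForms
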